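import Summits.PneNP.PneNP.Theses.PhaseTwins
import Summits.PneNP.PneNP.Theorems.NPNotSubsetPPoly
import Literature.Computability.Complexity.HardcoreInapproximability
import Literature.Computability.Complexity.CircuitComposition

/-!
# Skeleton line `minmax-tiny-twins` for crux `PhaseTwins.PseudorandomTwinsAbove` (stmt-PneNP-2721)

Crux (FIXED, by name): `Summit.PneNP.PneNP.Theses.PhaseTwins.PseudorandomTwinsAbove` —
`∃ Δ p q` above `λ_c(Δ)`, `∃` EXACTLY samplable ensembles `D₀ D₁` such that (i) every PPT test `A`
(INDEX-FREE: `A.pr id x {true}`, the test sees the sample only; `coinLen` = free `O(log |x|)` advice)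
has acceptance gap `→ 0`, and (ii) for a threshold `t`: `D₀(n){8 t(n) ≤ N} → 1`, `D₁(n){0 < N ≤ t(n)} → 1`,
`N = hardcoreCount Δ p q` (the inlined `match` of the route file IS `hardcoreCount`, by `rfl`).

## The line (crux idea `minmax-tiny-twins`, ideator 1, round 1; triage r1: 3 × pass; merged lever
## L1 = `minmax-tiny-twins ≈ minimax-bruteforce-tiny-twins ≈ length-advice-horizon(DOWNWARD)`)

LEVER: two-player duality at a scale the sampler can brute-force.  At graph size `m` (all codes of
`m`-vertex graphs share the length `ℓ = codeLen m`) and circuit budget `s`, EITHER there are dyadic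
TWINS — equal-length lists `X₀ ⊆ High_τ = {N ≥ 8τ}`, `X₁ ⊆ Low_τ = {0 < N ≤ τ}` of max-degree-`Δ` codes whose
uniform distributions fool every statistic `x ↦ Pr_r[F(x,r) = 1]` of a size-`s` probabilistic
`B₂`-circuit within `ε` (`Good`) — OR (finite LP duality = `stub_twinsOrSeparator`, then Lipton–Young
sparsification + Adleman fixing of coins = `stub_separatorToCircuit`) ONE `B₂`-circuit of size
`poly(s, ℓ, 1/ε)` decides the promise problem `High_τ` vs `Low_τ` on ALL of them (`Separable`).  A sampler
clocked in `n` but free to work at scale `m ≈ log log log n` plays this finite game EXACTLY by brute force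
and outputs a uniform element of the twin list (`stub_samplerFromGoodScales`, the XL TM2 stub); every
fixed PPT test, TOGETHER WITH its coin-length advice, is at each input length one small probabilistic
circuit (`stub_testsAreSmallCircuits`, `P ⊆ P/poly` — the ONE place the line consumes `A.IsPolyTime`),
hence fooled with advantage `≤ 1/(w⋆(n)+1) → 0`.  The second horn at every large scale is a
fixed-polynomial circuit family for an NP-hard gap problem; its negation is the line's single OPEN
input `stub_gapCircuitLowerBound` (≡ `NP ⊄ P/poly` in strength: implied by
`NPNotSubsetPPoly ∧ slyGadgetReduction`, see `Calibration`; implies `P ≠ NP`, as every sufficient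
hypothesis for this crux must — triage F1).

    stub_gapCircuitLowerBound ──┐
    stub_twinsOrSeparator ──────┼─> Good i.o. at every width w ──> stub_samplerFromGoodScales ──┐
    stub_separatorToCircuit ────┘      (good_io_of_lowerBound)                                 ├─> crux
    stub_testsAreSmallCircuits ────────────────────────────────────────────────────────────────┘
                                                                   (PseudorandomTwinsAbove_of)

## Disproof used (`Cruxes/PseudorandomTwinsAbove/Disproof.lean`, cdisprove cycle 1; landed Negative lemmas
## `Theorems/PseudorandomTwinsAbove/Negative/{FalseWithoutPolyTime,IndexedAndPositivity,TestClassKernels}.lean`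
## — read; not imported here only because the farm snapshot has not built them yet, 2026-08-16T02Z)
* `pseudorandomTwinsAbove_false_without_polyTime` (H = the time bound on tests): HONOURED — the line uses
  `A.IsPolyTime` exactly once and essentially, in `stub_testsAreSmallCircuits` (PPT ⇒ size-`ℓ^w` circuits);
  against ALL tests the duality's second horn always holds (the indicator of `High_τ` is a test) and
  `stub_gapCircuitLowerBound` would be false — matching `no_setwise_indistinguishable_far_pair`.
* `isPolyTime_coinLen_irrelevant` (coinLen = free advice): a FEATURE here — the advice value `coinLen ℓ`
  is just the number `a ≤ ℓ^w` of coin wires of the circuit; advised tests are fooled like the others.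
* `exists_close_pair_of_card_lt` (pigeonhole kernel) = the card's own dead end (i): POINT-MASS twins are
  killed by the differing-bit advice test; this line's twins are DISTRIBUTIONS (lists of length `2^j`),
  for which the only obstruction is horn 2, a worst-case DECIDER — a hardness statement, not a diagonal.
* `pseudorandomTwinsAboveWithoutPositivity_holds` (junk excluder `0 < N`): `Low` is built on canonical codes
  of max-degree-`Δ` graphs (`codes`), where `N ≥ q^m ≥ 1`; no undecodable string is ever output.
* `tv_lower_bound`: respected — `X₀ ⊆ High_τ`, `X₁ ⊆ Low_τ` are disjointly supported (TV = 1).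
* `sideConditions_satisfiable`: `(Δ,p,q) = (3,5,1)` is the instance of `Calibration`; the skeleton itself
  lets the open stub choose `(Δ,p,q)` (so a PCP/FGLSS discharge at huge `λ` is equally admissible).
* Negatives index (`ledger negatives --problem PneNP`, 2026-08-16: 0265, 0988, 10247, 2493, 2222): no stub
  is an instance; 2493 (BavardGap, small-`n` samplability) does not transfer — every property of the
  sampler here is asked only `∀ᶠ n`.
-/

set_option linter.dupNamespace false

noncomputable section

open scoped Classical
open Filter Topology

namespace Summit.PneNP.PneNP.Cruxes.PseudorandomTwinsAbove.MinmaxTinyTwins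

open Literature.Computability.Complexity Literature.Computability.MetaComplexity
open _root_.Computability

/-! ### §1 Vocabulary (finite, concrete; nothing posited) -/

/-- The common length `ℓ(m) = 2|bin m| + 2 + m²` of the codes `encodingGraph.encode ⟨m, G⟩` of ALL
graphs on `Fin m` (`length_encode`). -/
def codeLen (m : ℕ) : ℕ := 2 * (encodeNat m).length + 2 + m * m

/-- `U_m`: the canonical codes of the graphs on `Fin m` with maximum degree `≤ Δ` (the promise of
`hardcoreCount Δ p q`; on them `N ≥ q^m`). -/
def codes (Δ m : ℕ) : Finset (List Bool) :=
  ((Finset.univ : Finset (SimpleGraph (Fin m))).filter (fun G => G.maxDegree ≤ Δ)).image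
    (fun G => encodingGraph.encode ⟨m, G⟩)

/-- `High_τ(m) = {x ∈ U_m : 8τ ≤ N(x)}` — the YES side of the gap problem at scale `m`, threshold `τ`. -/
def High (Δ p q m τ : ℕ) : Finset (List Bool) :=
  (codes Δ m).filter (fun x => 8 * τ ≤ hardcoreCount Δ p q x)

/-- `Low_τ(m) = {x ∈ U_m : 0 < N(x) ≤ τ}` — the NO side (positivity kept verbatim from clause (ii)). -/
def Low (Δ p q m τ : ℕ) : Finset (List Bool) :=
  (codes Δ m).filter (fun x => 0 < hardcoreCount Δ p q x ∧ hardcoreCount Δ p q x ≤ τ)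

/-- A string as an input vector of `ℓ` wires (bits beyond `|x|` read `false`; only used at `|x| = ℓ`). -/
def bitsOf (x : List Bool) (ℓ : ℕ) : Fin ℓ → Bool := fun i => x.getD i false

/-- The STATISTIC of a probabilistic circuit `F` with `ℓ` input wires and `a` coin wires:
`x ↦ Pr_{r ∈ {0,1}^a}[F(x, r) = 1]` (the tree's `uniformProb`). -/
def pcStat (ℓ a : ℕ) (F : (Fin ℓ ⊕ Fin a → Bool) → Bool) (x : List Bool) : ℝ :=
  uniformProb a {r | F (Sum.elim (bitsOf x ℓ) (bitsOf r a)) = true}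

/-- `TestStat ℓ s`: the statistics of probabilistic `B₂`-circuits of size `≤ s` with `≤ s` coins at
input length `ℓ` (`CktSize` of `CircuitComposition.lean`).  Finite (`testStat_finite`), `[0,1]`-valued
(`testStat_mem_Icc`), monotone in `s` (`testStat_mono`). -/
def TestStat (ℓ s : ℕ) : Set (List Bool → ℝ) :=
  {g | ∃ a : ℕ, a ≤ s ∧ ∃ F : (Fin ℓ ⊕ Fin a → Bool) → Bool,
    CktSize B2 (fun w (_ : Unit) => F w) s ∧ g = pcStat ℓ a F}

/-- `Good Δ p q m s ε` — HORN 1 (dyadic twins at scale `m`): for some threshold `τ` there are lists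
`X₀ ⊆ High_τ(m)`, `X₁ ⊆ Low_τ(m)` of the same length `2^j` (so: uniform distributions samplable with
`j` fair coins, exactly) whose averages of every `g ∈ TestStat (codeLen m) s` differ by `≤ ε`. -/
def Good (Δ p q m s : ℕ) (ε : ℝ) : Prop :=
  ∃ (τ j : ℕ) (X₀ X₁ : List (List Bool)), X₀.length = 2 ^ j ∧ X₁.length = 2 ^ j ∧
    (∀ x ∈ X₀, x ∈ High Δ p q m τ) ∧ (∀ x ∈ X₁, x ∈ Low Δ p q m τ) ∧
    ∀ g ∈ TestStat (codeLen m) s, |(X₀.map g).sum / 2 ^ j - (X₁.map g).sum / 2 ^ j| ≤ ε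

/-- `Separable Δ p q m τ S` — HORN 2 at threshold `τ`: one `B₂`-circuit of size `≤ S` on `codeLen m`
wires accepts all of `High_τ(m)` and rejects all of `Low_τ(m)`. -/
def Separable (Δ p q m τ S : ℕ) : Prop :=
  ∃ F : (Fin (codeLen m) → Bool) → Bool, CktSize B2 (fun w (_ : Unit) => F w) S ∧
    (∀ x ∈ High Δ p q m τ, F (bitsOf x (codeLen m)) = true) ∧
    (∀ y ∈ Low Δ p q m τ, F (bitsOf y (codeLen m)) = false)

/-- THE OPEN INPUT.  `GapCircuitLowerBound Δ p q`: for every exponent `k`, at infinitely many scales `m`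
some NON-TRIVIAL threshold `τ` (both promise sides inhabited) admits NO separating `B₂`-circuit of size
`≤ ℓ(m)^k` — an i.o. fixed-polynomial circuit lower bound for the gap version of `hardcoreCount Δ p q`.
Strength: for `(Δ,p/q)` above `λ_c(Δ)` it follows from `NPNotSubsetPPoly ∧ slyGadgetReduction`
(`Calibration`) and it implies `P ≠ NP` (every sufficient hypothesis for this crux does: triage F1). -/
def GapCircuitLowerBound (Δ p q : ℕ) : Prop :=
  ∀ k m₀ : ℕ, ∃ m : ℕ, m₀ ≤ m ∧ ∃ τ : ℕ, (High Δ p q m τ).Nonempty ∧ (Low Δ p q m τ).Nonempty ∧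
    ¬ Separable Δ p q m τ (codeLen m ^ k)

/-! ### §1b Vocabulary lemmas (sorry-free; used by the composition) -/

/-- All codes of graphs on `Fin m` have length `codeLen m`. -/
theorem length_encode (m : ℕ) (G : SimpleGraph (Fin m)) :
    (encodingGraph.encode ⟨m, G⟩).length = codeLen m := by
  simp [encodingGraph_encode, encodingGraphFin, encodingBitVec, codeLen]

theorem length_of_mem_codes {Δ m : ℕ} {x : List Bool} (hx : x ∈ codes Δ m) :
    x.length = codeLen m := by
  obtain ⟨G, -, rfl⟩ := Finset.mem_image.1 hx
  exact length_encode m G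

theorem length_of_mem_High {Δ p q m τ : ℕ} {x : List Bool} (hx : x ∈ High Δ p q m τ) :
    x.length = codeLen m := length_of_mem_codes (Finset.mem_filter.1 hx).1

theorem length_of_mem_Low {Δ p q m τ : ℕ} {x : List Bool} (hx : x ∈ Low Δ p q m τ) :
    x.length = codeLen m := length_of_mem_codes (Finset.mem_filter.1 hx).1

theorem le_codeLen (m : ℕ) : m ≤ codeLen m := by
  unfold codeLen; nlinarith [Nat.zero_le m]

theorem two_le_codeLen (m : ℕ) : 2 ≤ codeLen m := by
  unfold codeLen; omega

/-- The route file's inlined hard-core count IS `hardcoreCount` (definitionally). -/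
theorem hardcoreCount_eq_inlined (Δ p q : ℕ) (x : List Bool) : hardcoreCount Δ p q x =
    (match encodingGraph.decode x with
      | none => 0
      | some G => if G.2.maxDegree ≤ Δ then ∑ I : Finset (Fin G.1),
          (if G.2.IsIndepSet (↑I : Set (Fin G.1)) then p ^ I.card * q ^ (G.1 - I.card) else 0)
        else 0) := rfl

theorem testStat_finite (ℓ s : ℕ) : (TestStat ℓ s).Finite := by
  have : TestStat ℓ s ⊆ ⋃ a ∈ Finset.range (s + 1),
      Set.range (fun F : (Fin ℓ ⊕ Fin a → Bool) → Bool => pcStat ℓ a F) := by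
    rintro g ⟨a, ha, F, -, rfl⟩
    exact Set.mem_iUnion₂.2 ⟨a, Finset.mem_range.2 (Nat.lt_succ_of_le ha), ⟨F, rfl⟩⟩
  exact Set.Finite.subset
    (Set.Finite.biUnion (Finset.finite_toSet _) fun a _ => Set.finite_range _) this

theorem testStat_mem_Icc {ℓ s : ℕ} {g : List Bool → ℝ} (hg : g ∈ TestStat ℓ s) (x : List Bool) :
    0 ≤ g x ∧ g x ≤ 1 := by
  obtain ⟨a, -, F, -, rfl⟩ := hg
  exact ⟨uniformProb_nonneg _ _, uniformProb_le_one _ _⟩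

theorem testStat_mono {ℓ s s' : ℕ} (h : s ≤ s') : TestStat ℓ s ⊆ TestStat ℓ s' := by
  rintro g ⟨a, ha, F, hF, rfl⟩
  exact ⟨a, ha.trans h, F, hF.of_le h, rfl⟩

theorem separable_mono {Δ p q m τ S S' : ℕ} (h : S ≤ S') (hs : Separable Δ p q m τ S) :
    Separable Δ p q m τ S' := by
  obtain ⟨F, hF, h1, h2⟩ := hs
  exact ⟨F, hF.of_le h, h1, h2⟩

/-- Monotonicity of `Ensemble.prob` (masses of a `PMF` are finite). -/
theorem prob_mono (D : Ensemble) (n : ℕ) {S T : Set (List Bool)} (h : S ⊆ T) :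
    D.prob n S ≤ D.prob n T := by
  unfold Ensemble.prob
  have hT : (D n).toOuterMeasure T ≠ ⊤ := by
    have h1 : (D n).toOuterMeasure T ≤ (D n).toOuterMeasure Set.univ :=
      PMF.toOuterMeasure_mono _ (Set.subset_univ _)
    rw [(PMF.toOuterMeasure_apply_eq_one_iff _ _).2 (Set.subset_univ _)] at h1
    exact (h1.trans_lt ENNReal.one_lt_top).ne
  exact ENNReal.toReal_mono hT ((D n).toOuterMeasure.mono h)

/-- A probability squeezed between an event of probability `1` and `1` is `1`. -/
theorem prob_eq_one_of_subset (D : Ensemble) (n : ℕ) {S T : Set (List Bool)} (h : S ⊆ T)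
    (hS : D.prob n S = 1) : D.prob n T = 1 :=
  le_antisymm (Ensemble.prob_le_one _ _ _) (hS ▸ prob_mono D n h)

/-- The one piece of arithmetic of the composition: the size bound of `stub_separatorToCircuit` at
`s = ℓ^w`, margin `1/(4w+4)`, is `≤ ℓ^((w+4)c+1)` once `ℓ ≥ max(3, 4w+6, c)`. -/
theorem sizeBound_le_pow {ℓ w c : ℕ} (h3 : 3 ≤ ℓ) (hw : 4 * w + 6 ≤ ℓ) (hc : c ≤ ℓ) :
    c * ((ℓ ^ w + 2) * (ℓ + 2) * (4 * w + 4 + 2)) ^ c ≤ ℓ ^ ((w + 4) * c + 1) := by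
  have hb : (ℓ ^ w + 2) * (ℓ + 2) * (4 * w + 4 + 2) ≤ ℓ ^ (w + 4) := by
    have e1 : ℓ ^ w + 2 ≤ ℓ ^ (w + 1) := by
      have : 1 ≤ ℓ ^ w := Nat.one_le_pow _ _ (by omega)
      calc ℓ ^ w + 2 ≤ ℓ ^ w * 3 := by omega
        _ ≤ ℓ ^ w * ℓ := Nat.mul_le_mul_left _ h3
        _ = ℓ ^ (w + 1) := (pow_succ ℓ w).symm
    have e2 : ℓ + 2 ≤ ℓ ^ 2 := by nlinarith
    have e3 : 4 * w + 4 + 2 ≤ ℓ := by omega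
    calc (ℓ ^ w + 2) * (ℓ + 2) * (4 * w + 4 + 2) ≤ ℓ ^ (w + 1) * ℓ ^ 2 * ℓ := by gcongr
      _ = ℓ ^ (w + 4) := by ring
  calc c * ((ℓ ^ w + 2) * (ℓ + 2) * (4 * w + 4 + 2)) ^ c ≤ ℓ * (ℓ ^ (w + 4)) ^ c := by gcongr
    _ = ℓ ^ ((w + 4) * c + 1) := by rw [← pow_mul]; ring

/-! ### §2 The statements of the line (named `Prop`s) -/

/-- STATEMENT 1 — finite min-max in DYADIC form ("twins or separator").  For finite non-empty `Hi`, `Lo`,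
a finite family `T` of `[0,1]`-valued tests and `ε > 0`: EITHER equal-power-of-two-length lists
`X₀ ⊆ Hi`, `X₁ ⊆ Lo` have all `T`-averages within `ε`, OR an `ℓ¹`-normalised signed combination of
finitely many tests from `T` exceeds some `θ` by `ε/4` on `Hi` and falls below `θ` by `ε/4` on `Lo`. -/
def TwinsOrSeparator : Prop :=
  ∀ {α : Type} (Hi Lo : Finset α), Hi.Nonempty → Lo.Nonempty →
    ∀ T : Set (α → ℝ), T.Finite → (∀ g ∈ T, ∀ x, 0 ≤ g x ∧ g x ≤ 1) → ∀ ε : ℝ, 0 < ε →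
      (∃ (j : ℕ) (X₀ X₁ : List α), X₀.length = 2 ^ j ∧ X₁.length = 2 ^ j ∧
        (∀ x ∈ X₀, x ∈ Hi) ∧ (∀ x ∈ X₁, x ∈ Lo) ∧
        ∀ g ∈ T, |(X₀.map g).sum / 2 ^ j - (X₁.map g).sum / 2 ^ j| ≤ ε) ∨
      (∃ (R : Finset (α → ℝ)) (c : (α → ℝ) → ℝ) (θ : ℝ), (↑R : Set (α → ℝ)) ⊆ T ∧
        (∑ g ∈ R, |c g|) = 1 ∧ (∀ x ∈ Hi, θ + ε / 4 ≤ ∑ g ∈ R, c g * g x) ∧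
        (∀ y ∈ Lo, ∑ g ∈ R, c g * g y ≤ θ - ε / 4))

/-- STATEMENT 2 — a separator over `TestStat ℓ s` with margin `γ` becomes ONE `B₂`-circuit of size
`poly(s, ℓ, 1/γ)` deciding `Hi` vs `Lo` (Lipton–Young sparsification of the weights + Adleman-style fixing
of the coins, union bounds over the `≤ 2^{ℓ+1}` points; then a signed counting/threshold circuit).
The polynomial is existential (`c`), uniform in all parameters. -/
def SeparatorToCircuit : Prop :=
  ∃ c : ℕ, ∀ (ℓ s : ℕ) (γ : ℝ), 0 < γ →
    ∀ Hi Lo : Finset (List Bool), (∀ x ∈ Hi, x.length = ℓ) → (∀ y ∈ Lo, y.length = ℓ) →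
    ∀ (R : Finset (List Bool → ℝ)) (c₀ : (List Bool → ℝ) → ℝ) (θ : ℝ),
      (↑R : Set (List Bool → ℝ)) ⊆ TestStat ℓ s → (∑ g ∈ R, |c₀ g|) = 1 →
      (∀ x ∈ Hi, θ + γ ≤ ∑ g ∈ R, c₀ g * g x) → (∀ y ∈ Lo, ∑ g ∈ R, c₀ g * g y ≤ θ - γ) →
      ∃ F : (Fin ℓ → Bool) → Bool,
        CktSize B2 (fun w (_ : Unit) => F w) (c * ((s + 2) * (ℓ + 2) * (⌈1 / γ⌉₊ + 2)) ^ c) ∧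
        (∀ x ∈ Hi, F (bitsOf x ℓ) = true) ∧ (∀ y ∈ Lo, F (bitsOf y ℓ) = false)

/-- STATEMENT 3 — uniform PPT tests WITH their coin-length advice are small probabilistic circuits at
every large input length: `x ↦ A.pr id x {true}` agrees on `{0,1}^ℓ` with a statistic in
`TestStat ℓ (ℓ^w)` (`P ⊆ P/poly` for the language of `A.run`, `exists_cktSize_boolPair_of_mem_PPoly`,
`RandAlg.pr_eq_uniformProb`; `a = A.coinLen ℓ ≤ poly(ℓ)`).  THE place where `A.IsPolyTime` is used. -/
def TestsAreSmallCircuits : Prop :=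
  ∀ A : RandAlg (List Bool) Bool, A.IsPolyTime (id : List Bool → List Bool) encodeBool →
    ∃ w ℓ₀ : ℕ, ∀ ℓ : ℕ, ℓ₀ ≤ ℓ → ∃ g ∈ TestStat ℓ (ℓ ^ w),
      ∀ x : List Bool, x.length = ℓ → A.pr id x {b | b = true} = g x

/-- STATEMENT 4 — the brute-force SAMPLER (the XL TM2 stub).  If for every width `w` good scales exist
beyond every bound, there are two EXACTLY polynomial-time samplable ensembles and scale/width/threshold
functions `m⋆, w⋆, τ⋆ → (∞, ∞, ·)` such that, for all large `n`, `D₀(n)` lives on `High_{τ⋆ n}(m⋆ n)`,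
`D₁(n)` on `Low_{τ⋆ n}(m⋆ n)`, and every function agreeing on `{0,1}^{ℓ(m⋆ n)}` with a statistic of
`TestStat (ℓ(m⋆ n)) (ℓ(m⋆ n)^{w⋆ n})` has expectation gap `≤ 1/(w⋆ n + 1)`.  (Construction: on `1ⁿ`
search the box `m, w, j, τ, X₀, X₁ ≤ B(n)` with `m ≥ w`, `B(n) → ∞` so slowly that the exhaustive check of
`Good`-witnesses — enumerate gate lists of size `≤ ℓ^w` over `B₂`, all `2^a` coin strings, exact rational
averages — costs `poly(n)`; take a witness of maximal `w` (canonical tie-break, the SAME for both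
samplers), output `X_b[first j coins]`; default output before the first witness appears.) -/
def SamplerFromGoodScales : Prop :=
  ∀ Δ p q : ℕ, (∀ w m₀ : ℕ, ∃ m : ℕ, m₀ ≤ m ∧ Good Δ p q m (codeLen m ^ w) (1 / ((w : ℝ) + 1))) →
    ∃ (D₀ D₁ : Ensemble) (mS wS τS : ℕ → ℕ),
      D₀.IsPolySamplable ∧ D₁.IsPolySamplable ∧ Tendsto mS atTop atTop ∧ Tendsto wS atTop atTop ∧
      ∀ᶠ n in atTop,
        D₀.prob n ↑(High Δ p q (mS n) (τS n)) = 1 ∧ D₁.prob n ↑(Low Δ p q (mS n) (τS n)) = 1 ∧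
        ∀ f : List Bool → ℝ,
          (∃ g ∈ TestStat (codeLen (mS n)) (codeLen (mS n) ^ wS n),
            ∀ x : List Bool, x.length = codeLen (mS n) → f x = g x) →
          |(∑' x : List Bool, ((D₀ n) x).toReal * f x) -
              (∑' x : List Bool, ((D₁ n) x).toReal * f x)| ≤ 1 / ((wS n : ℝ) + 1)

/-- STATEMENT 5 — THE OPEN INPUT at some admissible parameter triple: `GapCircuitLowerBound Δ p q` for some
`Δ ≥ 3`, `q > 0`, `p/q > λ_c(Δ)` (verbatim the crux's guard).  Not a work target for provers: it is
implied by `NPNotSubsetPPoly ∧ slyGadgetReduction` (`Calibration`, e.g. at `(3,5,1)`), or by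
`NPNotSubsetPPoly` + PCP/FGLSS at huge `λ`, and implies `P ≠ NP`. -/
def SomeGapCircuitLowerBound : Prop :=
  ∃ Δ p q : ℕ, 3 ≤ Δ ∧ 0 < q ∧ ((Δ : ℝ) - 1) ^ (Δ - 1) / ((Δ : ℝ) - 2) ^ Δ < (p : ℝ) / q ∧
    GapCircuitLowerBound Δ p q

/-- CALIBRATION (provable, size L; NOT a hypothesis of the composition — the recommended first
`--supports` deliverable, because it is what tenure needs: "rung #4 AS TYPED is ≤ `NP ⊄ P/poly`, not
cryptographic").  Contrapositive: if for some `k` every large scale `m` and every inhabited threshold `τ`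
has a size-`ℓ(m)^k` separator, then MAX-CUT ∈ P/poly: for an `N`-vertex instance `(H, K)` use Sly's
DERANDOMISED gadget `G_n` (fact `slyGadgetReduction`, `d = Δ = 3`, `λ = 5 > 4 = λ_c(3)`; `n = poly(N)` with
`N ≤ n^{θ/4}/2`) as ADVICE, the projection `H ↦ code(H^{G_n})` (`gadgetSubst`, max degree `≤ 3` by
`maxDegree_gadgetSubst_le`; one constant/projection gate per output bit) and the thresholds
`τ(N, |E(H)|, K, n)` read off `slyCutEstimate_of_slyProps` / `sum_hardcoreZOn_fiber` /
`eventually_mul_rpow_rpow_le_slyB_pow` (YES ≥ 8τ, NO ≤ τ), multiplexed over the `≤ N⁴` values of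
`(|E(H)|, K)`; then `MAXCUT_isNPHard` + `npNotSubsetPPoly_iff_holds` give `NP ⊆ P/poly`. -/
def Calibration : Prop :=
  Summit.PneNP.PneNP.NPNotSubsetPPoly → slyGadgetReduction → GapCircuitLowerBound 3 5 1

/-! ### §3 Registered stubs (`sorry` lives ONLY here; signatures = the statements above, expanded) -/

/-- **stub_twinsOrSeparator** (size M; TRUE — finite LP duality).  Let `ι := T` (finite) and
`K := {(E_{μ₀} g − E_{μ₁} g)_{g ∈ T} : μ₀ ∈ Δ(Hi), μ₁ ∈ Δ(Lo)} ⊂ ℝ^T`, convex and compact (image of a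
product of two standard simplices).  If `K` meets the cube `[−ε/2, ε/2]^T`, round the two optimal mixed
strategies to DYADIC weights `k_x/2^j` (round down, put the defect on one support point): total
variation `≤ |Hi ∪ Lo|·2^{-j} ≤ ε/4` each, and a dyadic distribution IS the uniform distribution on a list
of length `2^j` — horn 1 with `ε/2 + ε/4 + ε/4`.  Else `geometric_hahn_banach_compact_closed` separates
`K` from the cube by `z ↦ Σ_g c_g z_g`; normalise `Σ|c_g| = 1`, so `sup_cube = ε/2` and (flipping signs)
`Σ_g c_g (g(x) − g(y)) > ε/2` for all `x ∈ Hi`, `y ∈ Lo` (point masses); `θ :=` midpoint of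
`min_{Hi} Σ c_g g` and `max_{Lo} Σ c_g g` gives margins `ε/4` — horn 2.  (`T = ∅`: horn 1 with `j = 0`.)
Alternative: ONE application of tree `Literature.Analysis.Convex.MinMax.exists_mixed_of_forall_mixed`
(rows = `Hi × Lo`, columns = signed tests; sibling card minimax-bruteforce-tiny-twins) + the same rounding.
Leans on: Mathlib `geometric_hahn_banach_compact_closed`, `stdSimplex`, `isCompact_stdSimplex`,
`Finset.exists_min_image`/`exists_max_image`; tree `MinMax.exists_mixed_of_forall_mixed` (proved). -/
theorem stub_twinsOrSeparator :
    ∀ {α : Type} (Hi Lo : Finset α), Hi.Nonempty → Lo.Nonempty →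
    ∀ T : Set (α → ℝ), T.Finite → (∀ g ∈ T, ∀ x, 0 ≤ g x ∧ g x ≤ 1) → ∀ ε : ℝ, 0 < ε →
      (∃ (j : ℕ) (X₀ X₁ : List α), X₀.length = 2 ^ j ∧ X₁.length = 2 ^ j ∧
        (∀ x ∈ X₀, x ∈ Hi) ∧ (∀ x ∈ X₁, x ∈ Lo) ∧
        ∀ g ∈ T, |(X₀.map g).sum / 2 ^ j - (X₁.map g).sum / 2 ^ j| ≤ ε) ∨
      (∃ (R : Finset (α → ℝ)) (c : (α → ℝ) → ℝ) (θ : ℝ), (↑R : Set (α → ℝ)) ⊆ T ∧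
        (∑ g ∈ R, |c g|) = 1 ∧ (∀ x ∈ Hi, θ + ε / 4 ≤ ∑ g ∈ R, c g * g x) ∧
        (∀ y ∈ Lo, ∑ g ∈ R, c g * g y ≤ θ - ε / 4)) := by
  sorry

/-- **stub_separatorToCircuit** (size L; TRUE — Lipton–Young + Adleman + circuit bookkeeping).
Given the separator `Σ_{g∈R} c₀(g)·g` (`Σ|c₀| = 1`, margin `γ` around `θ`) with every `g = pcStat ℓ a_g F_g`,
`a_g ≤ s`, `CktSize B2 F_g s`: (1) sample `R₁ = ⌈8(ℓ+2)/γ²⌉` tests i.i.d. from `|c₀|` with their signs —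
by `hoeffding_weighted_pi` + union bound over the `≤ 2^{ℓ+1}` points of `Hi ∪ Lo` (all of length `ℓ`) some
sample has signed empirical mean within `γ/3` of `Σ c₀(g) g(x)` everywhere (pattern:
`HardCoreMinMax.exists_majority_sample`); (2) for each sampled `F_i` fix `R₂ = O((ℓ + log R₁)/γ²)` coin
strings so that the empirical frequency is within `γ/3` of `pcStat` at every point (same Hoeffding, as
in Adleman / `CircuitClassesProofs.exists_forall_notMem_of_small`); (3) the circuit: `R₁R₂` copies
`CktSize.hardwire`d on their coin wires (`≤ s` gates each, `CktSize.pi`), negate the copies with negative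
sign (`cktSize_not`), count the ones and compare with the constant threshold `⌈(θ·R₁R₂ + #neg·R₂)⌉`
(a `B₂` counting/threshold circuit, `O(R₁R₂ log(R₁R₂))` gates via `AdderBlocks`-style ripple adders or
`cktSize_univ` on `O(log)`-bit blocks).  Size `O(s·ℓ²/γ⁴·polylog) ≤ c·((s+2)(ℓ+2)(⌈1/γ⌉+2))^c`.
Degenerate cases: `Hi = ∅` or `Lo = ∅` ⇒ a constant circuit (`cktSize_const`); `ℓ = 0` ⇒ `Hi ∪ Lo ⊆ {[]}`,
not both inhabited (margins).  Leans on: tree `CktSize.{comp,pair,pi,hardwire,congr,of_le}`,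
`cktSize_const/not/and/or`, `cktSize_univ`, `hoeffding_weighted_pi`, `exists_majority_sample`,
`uniformProb` API; Mathlib `Real.exp` bounds, `Nat.ceil`. -/
theorem stub_separatorToCircuit :
    ∃ c : ℕ, ∀ (ℓ s : ℕ) (γ : ℝ), 0 < γ →
    ∀ Hi Lo : Finset (List Bool), (∀ x ∈ Hi, x.length = ℓ) → (∀ y ∈ Lo, y.length = ℓ) →
    ∀ (R : Finset (List Bool → ℝ)) (c₀ : (List Bool → ℝ) → ℝ) (θ : ℝ),
      (↑R : Set (List Bool → ℝ)) ⊆ TestStat ℓ s → (∑ g ∈ R, |c₀ g|) = 1 →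
      (∀ x ∈ Hi, θ + γ ≤ ∑ g ∈ R, c₀ g * g x) → (∀ y ∈ Lo, ∑ g ∈ R, c₀ g * g y ≤ θ - γ) →
      ∃ F : (Fin ℓ → Bool) → Bool,
        CktSize B2 (fun w (_ : Unit) => F w) (c * ((s + 2) * (ℓ + 2) * (⌈1 / γ⌉₊ + 2)) ^ c) ∧
        (∀ x ∈ Hi, F (bitsOf x ℓ) = true) ∧ (∀ y ∈ Lo, F (bitsOf y ℓ) = false) := by
  sorry

/-- **stub_testsAreSmallCircuits** (size M; TRUE — `P ⊆ P/poly`, proved in the tree).  From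
`A.IsPolyTime id encodeBool`: the language `L_A = {z : A.run (boolUnpair z).1 (boolUnpair z).2 = true}`
is in `Classes.P` (`PolyTimeComputable.comp_holds` with `polyTimeComputable_boolUnpair`, the normaliser
pattern of `NPSubsetBPPCollapse.lean` / `UDerand.sampleFn_mem_FP`), hence in `PPoly`
(`P_subset_PPoly_holds`); `exists_cktSize_boolPair_of_mem_PPoly` yields, for `|x| = ℓ` and
`a := A.coinLen ℓ ≤ p_A(ℓ)`, a `B₂` gate list of size `(2ℓ+2+a) + q(2ℓ+2+a)` computing
`w ↦ [boolPair (ofFn w∘inl) (ofFn w∘inr) ∈ L_A] = A.run x r` on `Fin ℓ ⊕ Fin a` wires; with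
`RandAlg.pr_eq_uniformProb` and `List.ofFn (bitsOf x ℓ) = x` (`|x| = ℓ`) the statistic `pcStat ℓ a F`
equals `A.pr id x {true}` on `{0,1}^ℓ`; choose `w` with `2ℓ+2+a + q(2ℓ+2+a) ≤ ℓ^w` and `a ≤ ℓ^w` for
`ℓ ≥ ℓ₀`.  This is the stub that USES the time bound on the tests (Disproof:
`pseudorandomTwinsAbove_false_without_polyTime`) and ABSORBS the coin-length advice
(`isPolyTime_coinLen_irrelevant`): the advice is the wire count `a`.  Leans on: tree
`P_subset_PPoly_holds`, `exists_cktSize_boolPair_of_mem_PPoly`, `RandAlg.pr_eq_uniformProb`,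
`polyTimeComputable_boolUnpair`, `PolyTimeComputable.comp_holds`; Mathlib `List.ofFn`, `Polynomial.eval`
growth (`Polynomial.exists_le_pow`-type bounds as in `CircuitClassesProofs`). -/
theorem stub_testsAreSmallCircuits :
    ∀ A : RandAlg (List Bool) Bool, A.IsPolyTime (id : List Bool → List Bool) encodeBool →
      ∃ w ℓ₀ : ℕ, ∀ ℓ : ℕ, ℓ₀ ≤ ℓ → ∃ g ∈ TestStat ℓ (ℓ ^ w),
        ∀ x : List Bool, x.length = ℓ → A.pr id x {b | b = true} = g x := by
  sorry

/-- **stub_samplerFromGoodScales** (size XL — the TM2 construction; TRUE and unconditional; HARDEST TO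
BUILD).  See `SamplerFromGoodScales` for the construction.  What must be formalised: (a) the two samplers
`S_b : RandAlg ℕ (List Bool)` on `1ⁿ` as `FP` string functions built from the tree's bricks (box search
with budget `B(n)`; `hardcoreCount Δ p q` by exhaustive enumeration of vertex subsets; `encodingGraph`
codes; enumeration of `B₂` gate lists of size `≤ s` on `Fin ℓ ⊕ Fin a` wires and their evaluation —
`CircuitEvalPrograms.lean`; exact dyadic averages as integer comparisons after clearing `2^{a+j}`;
canonical argmax), (b) `IsPolyTime unaryEncodeNat id` from an explicit budget (`B(n)` = iterated
logarithm, or the largest `b` whose explicit cost tower is `≤ n`; patterns `UDerand.mixSampler_isPolyTime`,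
`GStmt.polyTimeComputable_out`, `ClockedUS.clockedUniversalSimulation_holds'` if a clocked self-simulation
is preferred), (c) the output law: `outputPMF = (uniform on {0,1}^{coinLen n}).map (X_b[first j bits])`
is uniform on the list `X_b` (`2^j ∣ 2^{coinLen n}`), whence `prob (High) = 1`, `prob (Low) = 1` and
`∑' x, D_b(n)(x)·f(x) = (X_b.map f).sum / 2^j = (X_b.map g).sum / 2^j` for `f = g` on `{0,1}^{ℓ(m⋆ n)}`
(`length_of_mem_High/Low`), so `Good` gives the gap `≤ 1/(w⋆ n + 1)`; (d) `w⋆ n → ∞` (the witness for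
width `W` has finite size, inside the box eventually; `w⋆` = max found) and `m⋆ n ≥ w⋆ n` by the search
constraint `m ≥ w` (available since the hypothesis gives good scales beyond every `m₀`).  Default output
(no witness yet in the box) is excluded by `∀ᶠ n`.  Leans on: tree `Ensemble.IsPolySamplable`,
`RandAlg.outputPMF/pr`, `RandAlg.pr_eq_uniformProb`, `prob_eq_uniformProb_of_sampler`
(`UniformDerandomizationEquiv.lean`), the `Brick`/`Plumb`/`FPStringBricks`/`FoldBricks`/`GenPrograms`
toolkits, `PolyTimeComputable.comp_holds`; Mathlib `PMF.map`, `PMF.uniformOfFintype`, `tsum` over finite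
support (`tsum_eq_sum`). -/
theorem stub_samplerFromGoodScales :
    ∀ Δ p q : ℕ, (∀ w m₀ : ℕ, ∃ m : ℕ, m₀ ≤ m ∧ Good Δ p q m (codeLen m ^ w) (1 / ((w : ℝ) + 1))) →
    ∃ (D₀ D₁ : Ensemble) (mS wS τS : ℕ → ℕ),
      D₀.IsPolySamplable ∧ D₁.IsPolySamplable ∧ Tendsto mS atTop atTop ∧ Tendsto wS atTop atTop ∧
      ∀ᶠ n in atTop,
        D₀.prob n ↑(High Δ p q (mS n) (τS n)) = 1 ∧ D₁.prob n ↑(Low Δ p q (mS n) (τS n)) = 1 ∧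
        ∀ f : List Bool → ℝ,
          (∃ g ∈ TestStat (codeLen (mS n)) (codeLen (mS n) ^ wS n),
            ∀ x : List Bool, x.length = codeLen (mS n) → f x = g x) →
          |(∑' x : List Bool, ((D₀ n) x).toReal * f x) -
              (∑' x : List Bool, ((D₁ n) x).toReal * f x)| ≤ 1 / ((wS n : ℝ) + 1) := by
  sorry

/-- **stub_gapCircuitLowerBound** (OPEN — `NP ⊄ P/poly`-strength; the line's single conditional input,
NOT a prover target).  `∃ (Δ,p,q)` above `λ_c(Δ)` with `GapCircuitLowerBound Δ p q`.  Why believed: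
`Calibration` (from `NPNotSubsetPPoly ∧ slyGadgetReduction` at `(3,5,1)`); gadget-free alternative at
`(Δ, 2^K, 1)`, `K = ⌈8/γ⌉`, from `NPNotSubsetPPoly` + a PCP gap for bounded-occurrence 3SAT + FGLSS
(`λ^α ≤ N ≤ 2^v λ^α`; triage r1-1 sharpen).  Why it cannot be landed: it implies `P ≠ NP`
(`P = NP ⇒ GapN ∈ P ⇒` size-`ℓ^k` separators a.e.).  A lead ends this crux AT BEST
`closed modulo {stub_gapCircuitLowerBound}` — which is the honest content of rung #4 as typed
(triage F1; route why-might-fail of 2721). -/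
theorem stub_gapCircuitLowerBound :
    ∃ Δ p q : ℕ, 3 ≤ Δ ∧ 0 < q ∧ ((Δ : ℝ) - 1) ^ (Δ - 1) / ((Δ : ℝ) - 2) ^ Δ < (p : ℝ) / q ∧
      GapCircuitLowerBound Δ p q := by
  sorry

/-! ### §4 Consistency: each named statement IS its registered stub (definitionally) -/

theorem twinsOrSeparator_holds : TwinsOrSeparator := stub_twinsOrSeparator
theorem separatorToCircuit_holds : SeparatorToCircuit := stub_separatorToCircuit
theorem testsAreSmallCircuits_holds : TestsAreSmallCircuits := stub_testsAreSmallCircuits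
theorem samplerFromGoodScales_holds : SamplerFromGoodScales := stub_samplerFromGoodScales
theorem someGapCircuitLowerBound_holds : SomeGapCircuitLowerBound := stub_gapCircuitLowerBound

/-! ### §5 Name-keyed aliases of the five statements (hypotheses of the composition) -/
namespace Registered

/-- Alias of `TwinsOrSeparator` keyed by the registered stub name. -/
abbrev stub_twinsOrSeparator : Prop := TwinsOrSeparator
/-- Alias of `SeparatorToCircuit` keyed by the registered stub name. -/
abbrev stub_separatorToCircuit : Prop := SeparatorToCircuit
/-- Alias of `TestsAreSmallCircuits` keyed by the registered stub name. -/
abbrev stub_testsAreSmallCircuits : Prop := TestsAreSmallCircuits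
/-- Alias of `SamplerFromGoodScales` keyed by the registered stub name. -/
abbrev stub_samplerFromGoodScales : Prop := SamplerFromGoodScales
/-- Alias of `SomeGapCircuitLowerBound` keyed by the registered stub name. -/
abbrev stub_gapCircuitLowerBound : Prop := SomeGapCircuitLowerBound

end Registered

/-! ### §6 The composition (kernel-checked, no `sorry`) -/

/-- THE DICHOTOMY TURNED AROUND: the circuit lower bound at `(Δ,p,q)` plus statements 1–2 give good
scales beyond every bound, for every width `w` (margin `1/(w+1)`, circuit budget `ℓ^w`).  Proof: at a
hard scale `m ≥ max(m₀, 4w+6, c, 3)` for the exponent `k = (w+4)c + 1`, horn 2 of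
`stub_twinsOrSeparator` would, through `stub_separatorToCircuit` (margin `1/(4w+4)`), produce a separator
of size `c·((ℓ^w+2)(ℓ+2)(4w+6))^c ≤ ℓ^k` (`sizeBound_le_pow`) — excluded; so horn 1 holds. -/
theorem good_io_of_lowerBound {Δ p q : ℕ} (h₁ : TwinsOrSeparator) (h₂ : SeparatorToCircuit)
    (hGap : GapCircuitLowerBound Δ p q) :
    ∀ w m₀ : ℕ, ∃ m : ℕ, m₀ ≤ m ∧ Good Δ p q m (codeLen m ^ w) (1 / ((w : ℝ) + 1)) := by
  obtain ⟨c, hc⟩ := h₂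
  intro w m₀
  set ε : ℝ := 1 / ((w : ℝ) + 1) with hε
  have hεpos : 0 < ε := by positivity
  obtain ⟨m, hm, τ, hHi, hLo, hnsep⟩ :=
    hGap ((w + 4) * c + 1) (max m₀ (max (4 * w + 6) (max c 3)))
  refine ⟨m, (le_max_left _ _).trans hm, ?_⟩
  have hℓ : max (4 * w + 6) (max c 3) ≤ codeLen m :=
    ((le_max_right _ _).trans hm).trans (le_codeLen m)
  have hw6 : 4 * w + 6 ≤ codeLen m := (le_max_left _ _).trans hℓ
  have hcℓ : c ≤ codeLen m := (le_max_left _ _).trans ((le_max_right _ _).trans hℓ)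
  have h3 : 3 ≤ codeLen m := (le_max_right _ _).trans ((le_max_right _ _).trans hℓ)
  rcases h₁ (High Δ p q m τ) (Low Δ p q m τ) hHi hLo (TestStat (codeLen m) (codeLen m ^ w))
      (testStat_finite _ _) (fun g hg x => testStat_mem_Icc hg x) ε hεpos with
    ⟨j, X₀, X₁, h0, h1, hX₀, hX₁, hfool⟩ | ⟨R, cf, θ, hR, hsum, hθHi, hθLo⟩
  · exact ⟨τ, j, X₀, X₁, h0, h1, hX₀, hX₁, hfool⟩
  · exfalso
    have hγ : 0 < ε / 4 := by positivity
    obtain ⟨F, hF, hFHi, hFLo⟩ := hc (codeLen m) (codeLen m ^ w) (ε / 4) hγ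
      (High Δ p q m τ) (Low Δ p q m τ) (fun x hx => length_of_mem_High hx)
      (fun y hy => length_of_mem_Low hy) R cf θ hR hsum hθHi hθLo
    apply hnsep
    refine separable_mono ?_ ⟨F, hF, hFHi, hFLo⟩
    have hceil : ⌈1 / (ε / 4)⌉₊ = 4 * w + 4 := by
      have : (1 : ℝ) / (ε / 4) = ((4 * w + 4 : ℕ) : ℝ) := by
        rw [hε]; push_cast; field_simp
      rw [this, Nat.ceil_natCast]
    rw [hceil]
    exact sizeBound_le_pow h3 hw6 hcℓ

/-- **`PseudorandomTwinsAbove` from the five stubs** (bookkeeping only).  The open input fixes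
`(Δ,p,q)`; `good_io_of_lowerBound` feeds `stub_samplerFromGoodScales`; clause (ii) holds because `D₀(n)`,
`D₁(n)` eventually live on `High`/`Low` (probability squeezed to `1`); clause (i): a PPT test is, at the
sampler's length `ℓ(m⋆ n) ≥ ℓ₀` and width `w⋆ n ≥ w_A`, a statistic of `TestStat ℓ (ℓ^{w⋆ n})`
(`stub_testsAreSmallCircuits` + monotonicity), so its gap is `≤ 1/(w⋆ n + 1) → 0`. -/
theorem PseudorandomTwinsAbove_of
    (h₁ : Registered.stub_twinsOrSeparator) (h₂ : Registered.stub_separatorToCircuit)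
    (h₃ : Registered.stub_testsAreSmallCircuits) (h₄ : Registered.stub_samplerFromGoodScales)
    (h₅ : Registered.stub_gapCircuitLowerBound) :
    Summit.PneNP.PneNP.Theses.PhaseTwins.PseudorandomTwinsAbove := by
  obtain ⟨Δ, p, q, hΔ, hq, hlam, hGap⟩ := h₅
  have hio := good_io_of_lowerBound (Δ := Δ) (p := p) (q := q) h₁ h₂ hGap
  obtain ⟨D₀, D₁, mS, wS, τS, hS₀, hS₁, hmS, hwS, hev⟩ := h₄ Δ p q hio
  refine ⟨Δ, p, q, hΔ, hq, hlam, D₀, D₁, hS₀, hS₁, ?_, τS, ?_, ?_⟩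
  · -- clause (i): every index-free PPT test is eventually one of the fooled statistics
    intro A hA
    obtain ⟨w, ℓ₀, hwℓ⟩ := h₃ A hA
    have hbound : ∀ᶠ n in atTop,
        |(∑' x : List Bool, ((D₀ n) x).toReal * A.pr id x {b | b = true}) -
            (∑' x : List Bool, ((D₁ n) x).toReal * A.pr id x {b | b = true})| ≤
          1 / ((wS n : ℝ) + 1) := by
      filter_upwards [hev, hmS.eventually_ge_atTop ℓ₀, hwS.eventually_ge_atTop w] with n hn hm hw
      obtain ⟨-, -, hfool⟩ := hn
      apply hfool
      obtain ⟨g, hg, hagree⟩ := hwℓ (codeLen (mS n)) (hm.trans (le_codeLen _))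
      refine ⟨g, testStat_mono ?_ hg, hagree⟩
      exact Nat.pow_le_pow_right (lt_of_lt_of_le (by norm_num) (two_le_codeLen _)) hw
    have hlim : Tendsto (fun n => 1 / ((wS n : ℝ) + 1)) atTop (nhds 0) :=
      tendsto_one_div_add_atTop_nhds_zero_nat.comp hwS
    exact squeeze_zero' (Eventually.of_forall fun n => abs_nonneg _) hbound hlim
  · -- clause (ii), YES side: `D₀(n)(High) = 1` eventually and `High ⊆ {8 τ ≤ N}`
    show Tendsto (fun n : ℕ => D₀.prob n {x | 8 * τS n ≤ hardcoreCount Δ p q x}) atTop (nhds 1)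
    refine tendsto_const_nhds.congr' ?_
    filter_upwards [hev] with n hn
    refine (prob_eq_one_of_subset D₀ n (fun x hx => ?_) hn.1).symm
    exact (Finset.mem_filter.1 (Finset.mem_coe.1 hx)).2
  · -- clause (ii), NO side: `D₁(n)(Low) = 1` eventually and `Low ⊆ {0 < N ≤ τ}`
    show Tendsto (fun n : ℕ => D₁.prob n
      {x | 0 < hardcoreCount Δ p q x ∧ hardcoreCount Δ p q x ≤ τS n}) atTop (nhds 1)
    refine tendsto_const_nhds.congr' ?_
    filter_upwards [hev] with n hn
    refine (prob_eq_one_of_subset D₁ n (fun x hx => ?_) hn.2.1).symm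
    exact (Finset.mem_filter.1 (Finset.mem_coe.1 hx)).2

/-- Wiring check: the registered stubs feed `PseudorandomTwinsAbove_of` as stated — the crux decl is
inhabited modulo the five `sorry`s and nothing else. -/
theorem PseudorandomTwinsAbove_of_stubs : Summit.PneNP.PneNP.Theses.PhaseTwins.PseudorandomTwinsAbove :=
  PseudorandomTwinsAbove_of stub_twinsOrSeparator stub_separatorToCircuit stub_testsAreSmallCircuits
    stub_samplerFromGoodScales stub_gapCircuitLowerBound

/-- How the open stub is fed from the registered conjecture (modus ponens, recorded for the lead):
`Calibration` + `NPNotSubsetPPoly` + `slyGadgetReduction` give `stub_gapCircuitLowerBound` at `(3,5,1)`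
(`λ = 5 > 4 = λ_c(3)`, the disprover's `sideConditions_satisfiable`). -/
theorem gapCircuitLowerBound_of_calibration (hcal : Calibration)
    (hNP : Summit.PneNP.PneNP.NPNotSubsetPPoly) (hSly : slyGadgetReduction) :
    Registered.stub_gapCircuitLowerBound :=
  ⟨3, 5, 1, le_rfl, Nat.one_pos, by norm_num, hcal hNP hSly⟩

/-! ### §7 Scratch checks -/

/-- The inlined count of the route file is `hardcoreCount` and its guard at `(3,5,1)` holds. -/
example : ((3 : ℝ) - 1) ^ (3 - 1) / ((3 : ℝ) - 2) ^ 3 < (5 : ℝ) / 1 := by norm_num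

/-- `codeLen` is the length of the code of every graph: `codeLen 3 = 2·|bin 3| + 2 + 9`. -/
example : (encodingGraph.encode ⟨3, ⊥⟩).length = codeLen 3 := length_encode 3 ⊥

end Summit.PneNP.PneNP.Cruxes.PseudorandomTwinsAbove.MinmaxTinyTwins

end
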